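import Summits.HodgeConjecture.HodgeConjecture.Theorems.WeilTypeLadderTensorBlochSeed
import Literature.AlgebraicGeometry.HodgeTheory.WeilClassesCMBlochSeed
import Literature.AlgebraicGeometry.HodgeTheory.HyperplaneClassRational
import HarnessLib

/-!
# WeilTypeLadder · the BLOCH TWIN of the crux line `perry-cm-tower-all-d`: ALL Weil sixfolds from Deligne's CM-anchored
# family with its global `√-d`, Bloch's theorem, and K-SYMMETRIC Bloch seeds at the CM sixfolds

b2b cell `hweil` (packet `run/shared/lean/b2b/hodge-weil/`, LADDER `## CARVER v5/v6` C33 (d), C39, `## P2g5`). Prover 2,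
generation 5 (variational chair). Nothing here is a new case of the Hodge conjecture and no named fact is introduced. The
file composes, BY NAME and with every open input a HYPOTHESIS:

* `hGA` — VERBATIM the registered Stub 1 `stub_cmAnchoredWeilFamilyAllD` of the crux line `perry-cm-tower-all-d` of
  stmt-HodgeConjecture-2524 (`Summits/…/Cruxes/WeilSixfolds/Lines/perry_cm_tower_all_d.lean`, crux-strategist
  2026-08-17): for `d ≥ 1`, a `√-d`-sixfold `(X, Φ)` and a non-zero rational `(3,3)` class of its Weil plane, Deligne's
  smooth projective family through `X`, closed in `ℙᴺ × S` over a smooth irreducible quasi-projective base, WITH its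
  global endomorphism `g` over `S` (the `√-d`, abelian charts on every fibre), a continuous fibrewise-`(3,3)` section `σ`
  through the class, and a CM TENSOR anchor `Y ≅ 𝒳_{s₀}` (`(Y, Ψ)` in flat isogeny correspondence with
  `(A₁ × A₁, (x,y) ↦ (-d·y, x))`, `A₁ ~ E³`, `ψ² = -d` on `E`, `g` inducing `Ψ`) with `σ(s₀)` in the Weil plane of
  `(Y, Ψ)` — Deligne, LNM 900, proof of Thm. 4.8 (a)–(c); van Geemen, LNM 1594, 5.3–5.11; Landherr (SOURCE REFEREED;
  the tree constructs no Shimura family, which is why it is a stub there and a hypothesis here);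
* `hB : BlochSemiregularSpread 6 3` — Bloch's semiregularity theorem, class level (tree fact, REFEREED: Bloch 1972
  (7.4)/(7.5) = Buchweitz–Flenner 2003 Thm. 5.2 = Voisin L7 Thm. 2.4; on-path: `blochSemiregularSpread_of_hodgeConjecture`);
* `hS : ∀ d ≥ 1, HasCMBlochSeeds d` — the DESIGN input (`Literature/…/WeilClassesCMBlochSeed.lean`, this seat): at every
  CM tensor sixfold, for every `K`-SYMMETRISED hyperplane class `θ = d·ι^*a + Ψ^*ι^*a` and every non-zero rational Weil
  class `x`, a Bloch-semiregular integral local complete intersection threefold carrying `q·θ³ + x`;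

into **stmt-HodgeConjecture-2524** (`weilSixfolds_of_cmAnchoredFamily_of_blochSpread_of_cmBlochSeeds`), its class-level
form and R1′. MECHANISM (`weilClass_algebraic_six_of_cmAnchoredFamily_of_blochSpread_of_cmBlochSeeds`): the continuous
section is a global class `W` (`stub_globalClassEngine`, proved in the tree from Deligne 1968), rational along `σ`
(`stub_rationalAlongSection`); all fibres embed in one `ℙᵐ` by `ε` (`exists_forall_isClosedImmersion_fiberι_comp`); the
GLOBAL action makes the `K`-symmetrised class GLOBAL — `H := d·ε^*a + g^*ε^*a` restricts on the anchor, through the chart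
`e₀` intertwining `g` and `Ψ`, to `θ = d·ι^*a + Ψ^*ι^*a` for the induced embedding `ι = e₀ ≫ ι_{s₀} ≫ ε` — and `H` is
fibrewise rational of type `(1,1)` because BOTH summands are restricted from projective space along morphisms
(`map_projectiveSpace_mem_algebraicClasses` needs no immersion); the seed for `q·θ³ + x₀` (`x₀ = 0`: `HasCMBlochSeeds.zero`)
makes `B := q·H³ + W` a global class, fibrewise rational `(3,3)`, restricting at `s₀` to a class supported on a
Bloch-semiregular integral lci; Bloch spreads algebraicity to an open `U ∋ s₀`, the algebraicity-locus theorem of the tree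
(`mem_algebraicClasses_of_isOpen_subset_algebraicityLocus`, Baire) to all of `S(ℂ)`; at `s₁` subtract `q·H³`
(Lefschetz (1,1) on `X`, `lefschetzOneOne_rational_holds`, and cup powers) and return along `e : X ≅ 𝒳_{s₁}`. NO Segre
symmetrisation of the embedding is needed (contrast `hodgeWeil_of_semiregularCleanLci_of_globalAction`, route
HeckePrymWeil, `p ≡ 3 (4)` prime): the seed's polarization input is the `K`-symmetrised CLASS, not a hyperplane class of a
`K`-symmetric embedding.

WHY THIS FILE (vs. door T∘S of `WeilTypeLadderTensorBlochSeed.lean`, this seat): there the family fact carries no global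
action, so the seed must serve EVERY raw hyperplane-type class of EVERY tensor point; here — at the price of taking
Deligne's construction in its CM-anchored, global-action form as the hypothesis `hGA` (a registered stub, refereed
source, not a tree fact) — the seed is needed only at the CM sixfolds `Y ~ E⁶` and only for `K`-symmetrised `θ`
(`Ψ^*θ = d·θ`, so `θ³ ⌣ x = 0`, `cupProduct_cupPowTwo_eq_zero_of_map_eq_smul_of_mem_weilClassesOf`, and the CM-square
design census of the packet, C36, applies verbatim). Compared with the Perry line itself: same Stub 1; Bloch's REFEREED
theorem replaces the Perry claim-fact (Stub 2, unrefereed) and the Chern-character construction debt (Stub 3); an lci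
THREEFOLD replaces the fully semiregular vector bundle (Stub 5); Markman's split theorem (Stub 4) is not used (no
hyperbolic escape is offered — a seed is asked at hyperbolic CM anchors too). HONEST COUNT: rungs proved unconditionally
above the floor — still 0.

## References
* [Deligne1982HodgeCycles] P. Deligne, Hodge cycles on abelian varieties, LNM 900 (1982), proof of Thm. 4.8 (pp. 47–52).
* [vanGeemen1994HodgeAV] B. van Geemen, LNM 1594 (1994), 5.3–5.11.
* [Landherr1936HermitianForms] W. Landherr, Abh. Math. Sem. Hamburg 11 (1936).
* [Bloch1972Semiregularity] S. Bloch, Invent. Math. 17 (1972), Thm. (7.4), Remark (7.5).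
* [BuchweitzFlenner2003] R.-O. Buchweitz, H. Flenner, Compositio Math. 137 (2003), Thm. 5.2.
* [VoisinTorino1994] C. Voisin, LNM 1594, Lecture 7, Thm. 2.4.
* [CharlesSchnell2014Notes] F. Charles, C. Schnell, Notes on absolute Hodge classes (2014), Prop. 11.3.11 (proof).
* [VoisinHodgeII2003] C. Voisin, Hodge Theory and Complex Algebraic Geometry II, §1.2.3 Cor. 1.24, §9.2.4 Prop. 9.20.
-/

-- every declaration of this problem lives in `Summit.HodgeConjecture.HodgeConjecture.…` (summit = sub-problem)
set_option linter.dupNamespace false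

noncomputable section

open CategoryTheory AlgebraicGeometry Limits MonoidalCategory CartesianMonoidalCategory

namespace Summit.HodgeConjecture.HodgeConjecture.WeilTypeLadder

open Literature.AlgebraicGeometry Literature.AlgebraicGeometry.Motives
open Literature.AlgebraicGeometry.HodgeTheory
open Literature.AlgebraicTopology.SingularHomology
open Summit.HodgeConjecture.HodgeConjecture.Theorems.HeckePrymWeilLine (stub_rationalAlongSection owf_isoTransport)
open Summit.HodgeConjecture.HodgeConjecture.Theorems.HyperbolicEightfoldsSqrtMinus7.TensorAnchor
open Summit.HodgeConjecture.HodgeConjecture.Theorems.HyperbolicEightfoldsSqrtMinus7.AnchorObject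
  (complexBetti_map_cupPowTwo cupPowTwo_mem_algebraicClasses_abelian)

/-- Contravariant functoriality on elements: `(f ≫ g)^* z = f^* (g^* z)`. [folklore] -/
theorem complexBetti_map_comp_apply' {X Y Z : SchemeOver ℂ} (f : X ⟶ Y) (g : Y ⟶ Z) (k : ℕ)
    (z : complexBetti Z k) : complexBetti.map (f ≫ g) k z = complexBetti.map f k (complexBetti.map g k z) := by
  rw [complexBetti.map_comp, CategoryTheory.comp_apply]

/-- **The CM-anchored Weil family with global action, every `d`** — VERBATIM the statement of the registered Stub 1
`stub_cmAnchoredWeilFamilyAllD` of the crux line `perry-cm-tower-all-d` (stmt-HodgeConjecture-2524), abbreviated HERE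
(Summit side, hypothesis of the theorems below; NOT a Literature fact of the tree, NOT asserted). Deligne's construction,
LNM 900, proof of Thm. 4.8 (a)–(c), with the diagonal CM member of van Geemen 5.4–5.7 as the tensor anchor.
[cite: Deligne1982HodgeCycles, proof of Thm. 4.8 (pp. 47–52)] [cite: vanGeemen1994HodgeAV, §5.3–5.11]
[cite: Landherr1936HermitianForms, Satz] [status: open] -/
@[conjecture] def CMAnchoredWeilFamilyAllD : Prop :=
  ∀ d : ℕ, 0 < d → ∀ (X : AbelianVariety ℂ) (Φ : X ⟶ X), X.dim = 2 * 3 → Φ ≫ Φ = -(d • 𝟙 X) →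
    ∀ c : complexBetti X.X (2 * 3), c ∈ weilClassesOf X Φ 3 d → c ≠ 0 → IsRationalClass c →
      IsOfHodgeType (2 * 3) X.X (2 * 3) 3 3 c →
      ∃ (𝒳 S : SchemeOver ℂ) (f : 𝒳 ⟶ S) (g : 𝒳 ⟶ 𝒳) (s₁ s₀ : ComplexPoints S) (e : X.X ≅ fiberOver f s₁)
        (σ : ComplexPoints S → FiberClass f (2 * 3)),
        IsSmoothProjectiveFamily f (2 * 3) ∧
        (∃ (N : ℕ) (ι : 𝒳 ⟶ projectiveSpace N ℂ ⊗ S), IsClosedImmersion ι.left ∧ ι ≫ snd (projectiveSpace N ℂ) S = f) ∧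
        IrreducibleSpace S.left ∧ AlgebraicGeometry.Smooth S.hom ∧ IsQuasiProjectiveOver S ∧ g ≫ f = f ∧
        (∀ s : ComplexPoints S, ∃ (A' : AbelianVariety ℂ) (φ' : A' ⟶ A') (e' : A'.X ≅ fiberOver f s),
            A'.dim = 2 * 3 ∧ φ' ≫ φ' = -(d • 𝟙 A') ∧
            (e'.hom ≫ fiberι f s) ≫ g = φ'.hom.hom.hom ≫ (e'.hom ≫ fiberι f s)) ∧
        (e.hom ≫ fiberι f s₁) ≫ g = Φ.hom.hom.hom ≫ (e.hom ≫ fiberι f s₁) ∧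
        Continuous σ ∧ (∀ s, (σ s).pt = s) ∧
        (∀ s, IsOfHodgeType (2 * 3) (fiberOver f (σ s).pt) (2 * 3) 3 3 (σ s).cls) ∧
        σ s₁ = ⟨s₁, complexBetti.map e.inv (2 * 3) c⟩ ∧
        ∃ (Y : AbelianVariety ℂ) (Ψ : Y ⟶ Y) (e₀ : Y.X ≅ fiberOver f s₀) (x : complexBetti (fiberOver f s₀) (2 * 3)),
          (∃ (A₁ : AbelianVariety ℂ) (f₁ : Y ⟶ A₁.prod A₁) (g₁ : A₁.prod A₁ ⟶ Y) (m : ℕ) (E : AbelianVariety ℂ)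
              (ψ : E ⟶ E) (f₂ : A₁ ⟶ (E.prod E).prod E) (g₂ : (E.prod E).prod E ⟶ A₁) (m₂ : ℕ),
              A₁.dim = 3 ∧ Y.dim = 6 ∧ Ψ ≫ Ψ = -(d • 𝟙 Y) ∧ 0 < m ∧ f₁ ≫ g₁ = m • 𝟙 Y ∧
              AlgebraicGeometry.Flat f₁.hom.hom.hom.left ∧
              g₁ ≫ Ψ = AbelianVariety.prodLift (AbelianVariety.snd A₁ A₁ ≫ (-(d • 𝟙 A₁))) (AbelianVariety.fst A₁ A₁) ≫ g₁ ∧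
              E.dim = 1 ∧ ψ ≫ ψ = -(d • 𝟙 E) ∧ 0 < m₂ ∧ f₂ ≫ g₂ = m₂ • 𝟙 A₁) ∧
          (e₀.hom ≫ fiberι f s₀) ≫ g = Ψ.hom.hom.hom ≫ (e₀.hom ≫ fiberι f s₀) ∧ σ s₀ = ⟨s₀, x⟩ ∧
          complexBetti.map e₀.hom (2 * 3) x ∈ weilClassesOf Y Ψ 3 d

/-! ## The mechanism: class level -/

/-- **Every rational `(3,3)` Weil class on every `√-d`-Weil abelian sixfold `(X, Φ)` (`Φ ≫ Φ = -d`, ANY discriminant) is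
algebraic, granting the CM-anchored global-action family, Bloch's theorem (class level, (6,3)) and `K`-symmetric Bloch
seeds at the CM sixfolds for this `d`** (`d ≥ 1`; hypotheses BY NAME, nothing asserted). Proof in the module docstring:
global `W` from `σ`; one `ℙᵐ` for all fibres; the GLOBAL `K`-symmetrised class `H := d·ε^*a + g^*ε^*a` restricting on the
anchor to `θ = d·ι^*a + Ψ^*ι^*a`; the seed for `q·θ³ + x₀`; Bloch at `s₀`; Baire; subtraction of `q·H³` at `s₁` by
Lefschetz (1,1); return along the chart. [cite: Deligne1982HodgeCycles, proof of Thm. 4.8 (a)–(c)]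
[cite: Bloch1972Semiregularity, Thm. (7.4) and Remark (7.5)] [cite: BuchweitzFlenner2003, Thm. 5.2]
[cite: CharlesSchnell2014Notes, Prop. 11.3.11 (proof)] [cite: VoisinHodgeII2003, §9.2.4 Prop. 9.20] -/
theorem weilClass_algebraic_six_of_cmAnchoredFamily_of_blochSpread_of_cmBlochSeeds (d : ℕ) (hd : 0 < d)
    (hGA : CMAnchoredWeilFamilyAllD) (hB : BlochSemiregularSpread 6 3) (hS : HasCMBlochSeeds d)
    (X : AbelianVariety ℂ) (Φ : X ⟶ X) (hX : X.dim = 2 * 3) (hΦ : Φ ≫ Φ = -(d • 𝟙 X))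
    (c : complexBetti X.X (2 * 3)) (hcW : c ∈ weilClassesOf X Φ 3 d) (hcr : IsRationalClass c)
    (hcH : IsOfHodgeType (2 * 3) X.X (2 * 3) 3 3 c) :
    c ∈ algebraicClasses X.X 3 := by
  by_cases hc0 : c = 0
  · rw [hc0]; exact Submodule.zero_mem _
  obtain ⟨𝒳, S, f, g, s₁, s₀, e, σ, hfam, hemb, hirr, hsm, hSqp, -, -, -, hσc, hpt, hσH, hσ₁, Y, Ψ, e₀, x,
      ⟨A₁, f₁, g₁, m', E, ψ, f₂, g₂, m₂, hA₁, hYdim, hΨ, hm', hfg, hflat, hg₁, hE, hψ, hm₂, hfg₂⟩, he₀g, hσ₀, hxW⟩ :=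
    hGA d hd X Φ hX hΦ c hcW hc0 hcr hcH
  haveI := hirr
  have h𝒳qp : IsQuasiProjectiveOver 𝒳 := by
    obtain ⟨N, ι, hι, -⟩ := hemb
    haveI := hι
    exact IsQuasiProjectiveOver.of_isClosedImmersion_projectiveSpace_tensor ι hSqp
  -- (1) the continuous section is a global class `W`, rational and `(3,3)` on every fibre
  obtain ⟨W, hWσ⟩ := stub_globalClassEngine f (2 * 3) (2 * 3) hfam hemb hsm hSqp hirr σ hσc hpt
  have hcls : ∀ (s : ComplexPoints S) (y : complexBetti (fiberOver f s) (2 * 3)),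
      σ s = ⟨s, y⟩ → complexBetti.map (fiberι f s) (2 * 3) W = y := by
    intro s y hy
    have h := (hWσ s).symm.trans hy
    simp only [globalSection, FiberClass.mk.injEq, heq_eq_eq, true_and] at h
    exact h
  have hW₁ : complexBetti.map (fiberι f s₁) (2 * 3) W = complexBetti.map e.inv (2 * 3) c := hcls s₁ _ hσ₁
  have hW₀ : complexBetti.map (fiberι f s₀) (2 * 3) W = x := hcls s₀ _ hσ₀
  have hrat₁ : IsRationalClass (σ s₁).cls := by rw [hσ₁]; exact hcr.map _
  have hratσ : ∀ s, IsRationalClass (σ s).cls :=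
    stub_rationalAlongSection f (2 * 3) (2 * 3) hfam hsm hSqp hirr σ hσc hpt s₁ hrat₁
  have hWfib : ∀ s, IsRationalClass (complexBetti.map (fiberι f s) (2 * 3) W) ∧
      IsOfHodgeType (2 * 3) (fiberOver f s) (2 * 3) 3 3 (complexBetti.map (fiberι f s) (2 * 3) W) := by
    intro s
    have h1 := hratσ s
    have h2 := hσH s
    rw [hWσ s] at h1 h2
    exact ⟨h1, h2⟩
  -- (2) one projective space for all fibres, `m ≥ 1`, a non-zero rational `a ∈ H²(ℙᵐ)`
  obtain ⟨mN, ε, hε⟩ := exists_forall_isClosedImmersion_fiberι_comp f hfam hemb hSqp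
  have hmN : 1 ≤ mN := by
    haveI := hε s₀
    exact le_trans (by norm_num)
      (le_of_isClosedImmersion_projectiveSpace (hfam.isSmoothProjective s₀) (fiberι f s₀ ≫ ε))
  obtain ⟨a, ha, ha0⟩ := exists_isRationalClass_ne_zero_projectiveSpace hmN
  -- (3) the GLOBAL `K`-symmetrised class `H := d·ε^*a + g^*ε^*a`
  set H : complexBetti 𝒳 2 := (d : ℂ) • complexBetti.map ε 2 a + complexBetti.map g 2 (complexBetti.map ε 2 a)
    with hHdef
  have hHs : ∀ s : ComplexPoints S, complexBetti.map (fiberι f s) 2 H =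
      (d : ℂ) • complexBetti.map (fiberι f s ≫ ε) 2 a + complexBetti.map (fiberι f s ≫ g ≫ ε) 2 a := by
    intro s
    rw [hHdef, map_add, map_smul, complexBetti_map_comp_apply', complexBetti_map_comp_apply',
      complexBetti_map_comp_apply']
  have hH : ∀ s : ComplexPoints S, IsRationalClass (complexBetti.map (fiberι f s) 2 H) ∧
      IsOfHodgeType (2 * 3) (fiberOver f s) 2 1 1 (complexBetti.map (fiberι f s) 2 H) := by
    intro s
    rw [hHs]
    refine ⟨?_, ?_⟩
    · have hr : IsRationalClass (((d : ℚ) : ℂ) • complexBetti.map (fiberι f s ≫ ε) 2 a +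
          complexBetti.map (fiberι f s ≫ g ≫ ε) 2 a) := ((ha.map _).smul (d : ℚ)).add (ha.map _)
      rwa [Rat.cast_natCast] at hr
    · have h1 : complexBetti.map (fiberι f s ≫ ε) (2 * 1) a ∈ algebraicClasses (fiberOver f s) 1 :=
        map_projectiveSpace_mem_algebraicClasses (hfam.isSmoothProjective s) _ 1 a
      have h2 : complexBetti.map (fiberι f s ≫ g ≫ ε) (2 * 1) a ∈ algebraicClasses (fiberOver f s) 1 :=
        map_projectiveSpace_mem_algebraicClasses (hfam.isSmoothProjective s) _ 1 a
      have h12 : (d : ℂ) • complexBetti.map (fiberι f s ≫ ε) (2 * 1) a +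
          complexBetti.map (fiberι f s ≫ g ≫ ε) (2 * 1) a ∈ algebraicClasses (fiberOver f s) 1 :=
        Submodule.add_mem _ (Submodule.smul_mem _ _ h1) h2
      exact isOfHodgeType_of_mem_algebraicClasses_of_isSmoothProjective (hfam.isSmoothProjective s) 1 h12
  -- (4) the induced projective embedding of the anchor and the `K`-symmetrised class `θ = e₀^*(H|_{s₀})`
  haveI : IsIso e₀.hom.left := (inferInstance : IsIso ((Over.forget _).mapIso e₀).hom)
  have hcl : IsClosedImmersion (e₀.hom ≫ fiberι f s₀ ≫ ε).left := by
    haveI := hε s₀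
    rw [Over.comp_left]
    infer_instance
  let ιY : ProjectiveEmbedding Y.X := ⟨mN, e₀.hom ≫ fiberι f s₀ ≫ ε, hcl⟩
  have hιa : complexBetti.map e₀.hom 2 (complexBetti.map (fiberι f s₀ ≫ ε) 2 a) = complexBetti.map ιY.ι 2 a :=
    (complexBetti_map_comp_apply' e₀.hom (fiberι f s₀ ≫ ε) 2 a).symm
  -- the chart intertwines `g` and `Ψ`: `e₀ ≫ ι_{s₀} ≫ g ≫ ε = Ψ ≫ ι_Y`
  have hgΨ : e₀.hom ≫ fiberι f s₀ ≫ g ≫ ε = Ψ.hom.hom.hom ≫ ιY.ι := by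
    change e₀.hom ≫ fiberι f s₀ ≫ g ≫ ε = Ψ.hom.hom.hom ≫ e₀.hom ≫ fiberι f s₀ ≫ ε
    have h := congrArg (· ≫ ε) he₀g
    simpa only [Category.assoc] using h
  have hga : complexBetti.map e₀.hom 2 (complexBetti.map (fiberι f s₀ ≫ g ≫ ε) 2 a) =
      complexBetti.map Ψ.hom.hom.hom 2 (complexBetti.map ιY.ι 2 a) := by
    have h := congrArg (fun φ => complexBetti.map φ 2 a) hgΨ
    simpa only [complexBetti_map_comp_apply'] using h
  have hH₀ : complexBetti.map e₀.hom 2 (complexBetti.map (fiberι f s₀) 2 H) =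
      (d : ℂ) • complexBetti.map ιY.ι 2 a + complexBetti.map Ψ.hom.hom.hom 2 (complexBetti.map ιY.ι 2 a) := by
    rw [hHs, map_add, map_smul, hιa, hga]
  -- (5) the transported class on the anchor and its Bloch seed (`x₀ = 0` from the seed of a non-zero class)
  set x₀ : complexBetti Y.X (2 * 3) := complexBetti.map e₀.hom (2 * 3) x with hx₀def
  have hx₀r : IsRationalClass x₀ := by rw [hx₀def, ← hW₀]; exact (hWfib s₀).1.map _
  have hseed : HasBlochSeedAt 3 Y
      ((d : ℂ) • complexBetti.map ιY.ι 2 a + complexBetti.map Ψ.hom.hom.hom 2 (complexBetti.map ιY.ι 2 a)) x₀ := by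
    by_cases hx0 : x₀ = 0
    · rw [hx0]
      exact hS.zero hd hA₁ hYdim hΨ hm' hfg hflat hg₁ hE hψ hm₂ hfg₂ ιY ha ha0
    · exact hS Y Ψ A₁ f₁ g₁ m' E ψ f₂ g₂ m₂ hA₁ hYdim hΨ hm' hfg hflat hg₁ hE hψ hm₂ hfg₂ ιY a ha ha0 x₀ hx₀r hxW hx0
  obtain ⟨Z, i, q, hi, hreg, hint, hcoh, hsr, hsupp⟩ := hseed
  -- (6) the global class `B := q·H³ + W`, Bloch at `s₀`, Baire on all of `S(ℂ)`
  set B : complexBetti 𝒳 (2 * 3) := ((q : ℚ) : ℂ) • cupPowTwo H 3 + W with hBdef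
  have hBres : ∀ s, complexBetti.map (fiberι f s) (2 * 3) B =
      ((q : ℚ) : ℂ) • cupPowTwo (complexBetti.map (fiberι f s) 2 H) 3 + complexBetti.map (fiberι f s) (2 * 3) W := by
    intro s
    rw [hBdef, map_add, map_smul, complexBetti_map_cupPowTwo]
  have hBrat : ∀ s : ComplexPoints S, IsRationalClass (complexBetti.map (fiberι f s) (2 * 3) B) ∧
      IsOfHodgeType (2 * 3) (fiberOver f s) (2 * 3) 3 3 (complexBetti.map (fiberι f s) (2 * 3) B) := by
    intro s
    rw [hBres]
    exact ⟨(((hH s).1.cupPowTwo 3).smul q).add (hWfib s).1,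
      ((isOfHodgeType_cupPowTwo (hfam.isSmoothProjective s) (hH s).2 3).smul _).add (hfam.isSmoothProjective s)
        (hWfib s).2⟩
  have hBx : complexBetti.map e₀.hom (2 * 3) (complexBetti.map (fiberι f s₀) (2 * 3) B) =
      ((q : ℚ) : ℂ) • cupPowTwo
          ((d : ℂ) • complexBetti.map ιY.ι 2 a + complexBetti.map Ψ.hom.hom.hom 2 (complexBetti.map ιY.ι 2 a)) 3 +
        x₀ := by
    rw [hBres, map_add, map_smul, complexBetti_map_cupPowTwo, hH₀, hW₀]
  obtain ⟨U, hUo, hs₀U, hU⟩ :=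
    hB Y.X Z i _ 𝒳 S f s₀ e₀ B hi hreg hint hcoh hsr hsupp hfam h𝒳qp hSqp hsm hBrat hBx
  have hBall : ∀ t : ComplexPoints S, complexBetti.map (fiberι f t) (2 * 3) B ∈ algebraicClasses (fiberOver f t) 3 :=
    mem_algebraicClasses_of_isOpen_subset_algebraicityLocus f h𝒳qp hSqp hsm hfam B hUo ⟨s₀, hs₀U⟩ hU
  -- (7) at `s₁`: subtract `q·H³` (Lefschetz (1,1) on `X`) and return along the chart
  have halg : ((q : ℚ) : ℂ) • cupPowTwo (complexBetti.map (fiberι f s₁) 2 H) 3 +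
      complexBetti.map (fiberι f s₁) (2 * 3) W ∈ algebraicClasses (fiberOver f s₁) 3 := by
    rw [← hBres s₁]; exact hBall s₁
  have hXsp : IsSmoothProjective (2 * 3) X.X := isSmoothProjective_of_dim_eq' hX
  have hh₁alg : complexBetti.map e.hom 2 (complexBetti.map (fiberι f s₁) 2 H) ∈ algebraicClasses X.X 1 :=
    lefschetzOneOne_rational_holds hXsp _ ((hH s₁).1.map _) ((hH s₁).2.map_of_iso e)
  have hh₁k : complexBetti.map e.hom (2 * 3) (cupPowTwo (complexBetti.map (fiberι f s₁) 2 H) 3) ∈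
      algebraicClasses X.X 3 := by
    rw [complexBetti_map_cupPowTwo]
    exact cupPowTwo_mem_algebraicClasses_abelian X hh₁alg 2
  have hHk : cupPowTwo (complexBetti.map (fiberι f s₁) 2 H) 3 ∈ algebraicClasses (fiberOver f s₁) 3 :=
    owf_isoTransport _ X e 3 _ hh₁k
  have hW₁alg : complexBetti.map e.inv (2 * 3) c ∈ algebraicClasses (fiberOver f s₁) 3 := by
    rw [← hW₁]
    have h := Submodule.sub_mem _ halg (Submodule.smul_mem _ (((q : ℚ) : ℂ)) hHk)
    rwa [add_sub_cancel_left] at h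
  have h := Theorems.isoInvariance_proof e 3 _ hW₁alg
  rwa [e.complexBetti_map_hom_map_inv] at h

/-! ## The rungs BY NAME -/

/-- **stmt-HodgeConjecture-2524 (`Theses.SevenfoldWeilCensus.WeilSixfolds`: ALL `√-d`-Weil abelian sixfolds, every `d`,
split AND non-split) ⟸ the CM-anchored global-action family ∧ `BlochSemiregularSpread 6 3` ∧ `K`-symmetric Bloch seeds
at the CM sixfolds for every `d ≥ 1`** — the Bloch twin of the crux line `perry-cm-tower-all-d`: Bloch's REFEREED theorem
in place of the Perry claim-fact, an integral lci threefold in place of a fully semiregular bundle; seed predicate = the one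
design input. [cite: Deligne1982HodgeCycles, proof of Thm. 4.8 (a)–(c)] [cite: Bloch1972Semiregularity, Thm. (7.4) and Remark (7.5)]
[cite: BuchweitzFlenner2003, Thm. 5.2] -/
theorem weilSixfolds_of_cmAnchoredFamily_of_blochSpread_of_cmBlochSeeds (hGA : CMAnchoredWeilFamilyAllD)
    (hB : BlochSemiregularSpread 6 3) (hS : ∀ d : ℕ, 0 < d → HasCMBlochSeeds d) :
    Theses.SevenfoldWeilCensus.WeilSixfolds := by
  refine weilSixfolds_iff_weilClassesOf.2 ?_
  intro d hd A φ hA _ hφ c hc h33 hcW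
  exact weilClass_algebraic_six_of_cmAnchoredFamily_of_blochSpread_of_cmBlochSeeds d hd hGA hB (hS d hd) A φ hA hφ c hcW
    hc h33

/-- **R1′ (`NonsplitSixfolds`) ⟸ the same three hypotheses** (the non-hyperbolicity clause of R1′ is not used).
[cite: Deligne1982HodgeCycles, proof of Thm. 4.8] [cite: Bloch1972Semiregularity, Thm. (7.4)] -/
theorem nonsplitSixfolds_of_cmAnchoredFamily_of_blochSpread_of_cmBlochSeeds (hGA : CMAnchoredWeilFamilyAllD)
    (hB : BlochSemiregularSpread 6 3) (hS : ∀ d : ℕ, 0 < d → HasCMBlochSeeds d) : NonsplitSixfolds := by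
  intro d hd A φ hA _ hφ _ c hc h33 hcW
  exact weilClass_algebraic_six_of_cmAnchoredFamily_of_blochSpread_of_cmBlochSeeds d hd hGA hB (hS d hd) A φ hA hφ c hcW
    hc h33

/-- **Per-`d` slice**: for a fixed `d ≥ 1`, every rational `(3,3)` Weil class of every `√-d`-sixfold is algebraic from the
family hypothesis, Bloch, and `HasCMBlochSeeds d` at that `d` alone — the statement a prover holding ONE construction at
ONE `d` closes (cf. `WeilTypeLadderSixfoldSlices.lean`). [cite: Deligne1982HodgeCycles, proof of Thm. 4.8]
[cite: Bloch1972Semiregularity, Thm. (7.4)] -/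
theorem weilSixfolds_slice_of_cmAnchoredFamily_of_blochSpread_of_cmBlochSeeds (d : ℕ) (hd : 0 < d)
    (hGA : CMAnchoredWeilFamilyAllD) (hB : BlochSemiregularSpread 6 3) (hS : HasCMBlochSeeds d) :
    ∀ (A : AbelianVariety ℂ) (φ : A ⟶ A), A.dim = 2 * 3 → φ ≫ φ = -(d • 𝟙 A) →
      ∀ c : complexBetti A.X (2 * 3), c ∈ weilClassesOf A φ 3 d → IsRationalClass c →
        IsOfHodgeType (2 * 3) A.X (2 * 3) 3 3 c → c ∈ algebraicClasses A.X 3 :=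
  fun A φ hA hφ c hcW hc h33 =>
    weilClass_algebraic_six_of_cmAnchoredFamily_of_blochSpread_of_cmBlochSeeds d hd hGA hB hS A φ hA hφ c hcW hc h33

/-! ## What is on-path -/

/-- **On-path bookkeeping**: under `HodgeConjecture`, Bloch's class-level theorem holds
(`blochSemiregularSpread_of_hodgeConjecture`) and so does the CONCLUSION (`WeilSixfolds`, a case of HC, by
`weilSixfolds_of_hodgeConjecture`-type lemmas of the ladder); neither the family hypothesis `CMAnchoredWeilFamilyAllD`
(a construction claim) nor the seed predicate (a design input) is implied by HC — recorded so that the DAG bookkeeping of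
the packet does not count them as rungs. Here: the transport input alone. [folklore] -/
theorem cmDoor_transport_of_hodgeConjecture (hHC : _root_.HodgeConjecture) : BlochSemiregularSpread 6 3 :=
  blochSemiregularSpread_of_hodgeConjecture hHC 6 3

end Summit.HodgeConjecture.HodgeConjecture.WeilTypeLadder

end
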